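import Literature.NumberTheory.LFunctions.DedekindZeta1LogFreeLemmaB
import HarnessLib

/-!
# Bombieri's Lemme B for `ζ₁_K(s) = (s − 1) ζ_K(s)` in degree `n_K ≤ 3`, uniformly in the field

Topic `Literature/NumberTheory/LFunctions`, namespace `Literature.NumberTheory.LFunctions.NumberField`.
Everything here is PROVED (theorems only; no definitions, no named facts).

The sibling file `DedekindZeta1LogFreeLemmaB.lean` proves Lemme B for `ζ₁_K` for `n_K ≤ 2` only: away from
the pole (`|v| ≥ 4e^{10} r`) the pole term `k!/|s₀ − 1|^{k+1}` of
`(ζ₁_K'/ζ₁_K)^{(k)}(s₀) = (−1)^k k!/(s₀ − 1)^{k+1} + (−1)^{k+1} k! r^{−k} n_K Σ_n b_n p_k(r log n)` was bounded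
there by HALF of the lower bound of Lemme A (`exists_norm_tsum_gTermB_ge_dedekindZeta₁`, slack `η = 2n_K`), and the
abstract series side of Lemme B (`LogFreeDensity.lemmeB_core_abstract`) takes a slack `η ≤ 4`.  In fact the same
hypothesis `|v| ≥ 4e^{10} r` makes the pole term at most a QUARTER of the Lemme-A lower bound
(`(2r/|s₀ − 1|)^{k+1} ≤ (e^{−10}/2)^{k+1} ≤ e^{−10K'}/4`, as `k + 1 ≥ 2`), so the slack is `η = (4/3) n_K ≤ 4`
for `n_K ≤ 3`:

* `exists_norm_tsum_gTermB_ge_dedekindZeta₁_sharp` — Lemme A on the series side with slack `(4/3) n_K`;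
* `lemmeB_dedekindZeta₁_of_finrank_le_three` — **Lemme B for `ζ₁_K`, `n_K ≤ 3`**, with the SAME absolute
  constants `A₀, r₀` shape and the SAME hypotheses as `lemmeB_dedekindZeta₁`, and the field-independent lower bound
  `e^{−10}/16 · x^{−r/10}/r³ ≤ ∫_{⌊x^{a₀}⌋}^{x} ‖Σ_{⌊x^{a₀}⌋ < n ≤ t, n ∈ G_z} b_n‖² dt/t` (`((4/3) n_K)² ≤ 16`).

This is the `χ = 1`, `n_K = 3` input of the log-free zero-density estimate for `ζ_K` of a cubic field
(Weiss 1983 Thm. 4.3 / Thorner–Zaman 2019 Thm. 3.2 without the Deuring–Heilbronn factor, for `H = Cl_K`), assembled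
in `DedekindZeta1LogFreeTheorem14DegreeThree.lean`.  Nothing in the sibling files is changed.

## References

* [Bombieri1987GrandCrible] E. Bombieri, Astérisque 18 (1987), §6 Lemme B (the case of `ζ`).
* [ThornerZaman2017] J. Thorner, A. Zaman, Algebra Number Theory 11 (2017), Lemma 5.4.
* [ThornerZaman2019] J. Thorner, A. Zaman, Algebra Number Theory 13 (2019) 1039–1068, Thm. 3.2 (arXiv:1803.02823 §3).
-/

noncomputable section

open Complex Metric Set Filter Finset
open scoped Real Topology LSeries.notation ArithmeticFunction.vonMangoldt

namespace Literature.NumberTheory.LFunctions.NumberField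

open Literature.NumberTheory.LFunctions.LogFreeLocal Literature.NumberTheory.LFunctions.LogFreeDensity
open scoped nonZeroDivisors _root_.NumberField

variable {K : Type*} [Field K] [NumberField K]

/-- **Lemme A on the series side for `ζ₁_K`, away from the pole, sharp slack** (`|v| ≥ 4e^{10} r`): with
the constant `c₄` of `lemmeA_dedekindZeta₁`, for `K' ≥ c₄ rL' + 2` there is `k ∈ [K', 2K']` with
`e^{−10K'} 2^{−(k+1)}/r ≤ (4/3) n_K ‖Σ_n b_n p_k(r log n)‖` (the pole term is at most a quarter of the Lemme-A
lower bound since `(2r/|s₀−1|)^{k+1} ≤ (e^{−10}/2)^{k+1} ≤ e^{−10K'}/4`).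
[cite: Bombieri1987GrandCrible, §6 Lemme B (proof)] -/
theorem exists_norm_tsum_gTermB_ge_dedekindZeta₁_sharp :
    ∃ c₄ : ℝ, 0 < c₄ ∧ ∀ (K : Type*) [Field K] [NumberField K],
      ∀ (v r L' : ℝ), lemmaAHeight K v ≤ L' → 0 < r → 512 * r ≤ 1 / 8 → 1 ≤ r * L' →
        4 * Real.exp 10 * r ≤ |v| →
        (∃ ρ₀ : ℂ, dedekindZeta₁ K ρ₀ = 0 ∧ ‖ρ₀ - (1 + (v : ℂ) * I)‖ ≤ r) →
        ∀ K' : ℕ, c₄ * (r * L') + 2 ≤ K' →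
          ∃ k ∈ Finset.Icc K' (2 * K'),
            Real.exp (-(10 * K')) * (2⁻¹ ^ (k + 1) / r) ≤
              4 / 3 * Module.finrank ℚ K * ‖∑' n, gTermB (coefB K 1 v) r k n‖ := by
  obtain ⟨c₄, h₄, hA⟩ := lemmeA_dedekindZeta₁
  refine ⟨c₄, h₄, fun K _ _ v r L' hL hr hr8 hu hv hzero K' hK' => ?_⟩
  obtain ⟨k, hk, hbound⟩ := hA K v r L' hL hr hr8 hu hzero K' hK'
  refine ⟨k, hk, ?_⟩
  rw [Finset.mem_Icc] at hk
  set s₀ : ℂ := ((1 + r : ℝ) : ℂ) + (v : ℂ) * I with hs₀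
  set N : ℝ := ‖∑' n, gTermB (coefB K 1 v) r k n‖ with hN
  have hnK : (0 : ℝ) < Module.finrank ℚ K := by exact_mod_cast Module.finrank_pos (R := ℚ) (M := K)
  have hfacpos : (0 : ℝ) < k.factorial := by positivity
  have h1 := hbound.trans (div_le_div_of_nonneg_right (norm_iteratedDeriv_logDeriv_dedekindZeta₁_le (K := K) v hr k) hfacpos.le)
  have hsimp : ((k.factorial : ℝ) * r⁻¹ ^ k * Module.finrank ℚ K * N + k.factorial / ‖s₀ - 1‖ ^ (k + 1)) / k.factorial =
      r⁻¹ ^ k * (Module.finrank ℚ K * N) + (‖s₀ - 1‖ ^ (k + 1))⁻¹ := by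
    field_simp
  rw [hsimp] at h1
  -- `K' ≥ 2`, hence `k + 1 ≥ 2`
  have hK'2 : (2 : ℝ) ≤ K' := by
    have : 0 ≤ c₄ * (r * L') := mul_nonneg h₄.le (by linarith)
    linarith
  have hk1 : 1 ≤ k := by
    have : (2 : ℝ) ≤ k := hK'2.trans (by exact_mod_cast hk.1)
    have h2 : 2 ≤ k := by exact_mod_cast this
    omega
  -- the pole term: `|s₀ − 1| ≥ |v| ≥ 4 e^{10} r`
  have hvs : 4 * Real.exp 10 * r ≤ ‖s₀ - 1‖ := by
    have him : (s₀ - 1).im = v := by simp [hs₀]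
    calc 4 * Real.exp 10 * r ≤ |v| := hv
      _ = |(s₀ - 1).im| := by rw [him]
      _ ≤ ‖s₀ - 1‖ := Complex.abs_im_le_norm _
  have hs₀1pos : 0 < ‖s₀ - 1‖ := lt_of_lt_of_le (by positivity) hvs
  have hpole : (‖s₀ - 1‖ ^ (k + 1))⁻¹ ≤ Real.exp (-(10 * K')) * (2 * r)⁻¹ ^ (k + 1) / 4 := by
    -- `(2r/|s₀−1|)^{k+1} ≤ (e^{-10}/2)^{k+1} ≤ e^{-10K'}/4`
    have hratio : 2 * r / ‖s₀ - 1‖ ≤ Real.exp (-10) / 2 := by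
      rw [div_le_div_iff₀ hs₀1pos two_pos]
      have h1 : Real.exp (-10) * ‖s₀ - 1‖ ≥ Real.exp (-10) * (4 * Real.exp 10 * r) :=
        mul_le_mul_of_nonneg_left hvs (Real.exp_pos _).le
      have he : Real.exp (-10) * Real.exp 10 = 1 := by rw [← Real.exp_add]; norm_num
      have h2 : Real.exp (-10) * (4 * Real.exp 10 * r) = 4 * r := by
        rw [show Real.exp (-10) * (4 * Real.exp 10 * r) = 4 * r * (Real.exp (-10) * Real.exp 10) by ring, he, mul_one]
      linarith
    have hratio0 : 0 ≤ 2 * r / ‖s₀ - 1‖ := by positivity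
    have hpow : (2 * r / ‖s₀ - 1‖) ^ (k + 1) ≤ (Real.exp (-10) / 2) ^ (k + 1) :=
      pow_le_pow_left₀ hratio0 hratio _
    have hek : (Real.exp (-10) / 2) ^ (k + 1) ≤ Real.exp (-(10 * K')) / 4 := by
      rw [div_pow]
      have h2k : (4 : ℝ) ≤ 2 ^ (k + 1) := by
        calc (4 : ℝ) = 2 ^ 2 := by norm_num
          _ ≤ 2 ^ (k + 1) := pow_le_pow_right₀ (by norm_num) (by omega)
      have hkr : (K' : ℝ) ≤ k := by exact_mod_cast hk.1
      have hexp : Real.exp (-10) ^ (k + 1) ≤ Real.exp (-(10 * K')) := by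
        rw [← Real.exp_nat_mul]
        exact Real.exp_le_exp.mpr (by push_cast; nlinarith only [hkr])
      exact div_le_div₀ (Real.exp_pos _).le hexp (by norm_num) h2k
    have heq : (‖s₀ - 1‖ ^ (k + 1))⁻¹ = (2 * r / ‖s₀ - 1‖) ^ (k + 1) * (2 * r)⁻¹ ^ (k + 1) := by
      rw [← mul_pow, ← inv_pow]; congr 1; field_simp
    rw [heq]
    calc (2 * r / ‖s₀ - 1‖) ^ (k + 1) * (2 * r)⁻¹ ^ (k + 1) ≤ (Real.exp (-(10 * K')) / 4) * (2 * r)⁻¹ ^ (k + 1) :=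
          mul_le_mul_of_nonneg_right (hpow.trans hek) (by positivity)
      _ = _ := by ring
  -- assemble: three quarters of the Lemme-A lower bound remain
  have hkey : 3 / 4 * (Real.exp (-(10 * K')) * (2 * r)⁻¹ ^ (k + 1)) ≤ r⁻¹ ^ k * (Module.finrank ℚ K * N) := by
    linarith
  have key : Real.exp (-(10 * K')) * (2⁻¹ ^ (k + 1) / r) = r ^ k * (Real.exp (-(10 * K')) * (2 * r)⁻¹ ^ (k + 1)) := by
    rw [mul_inv, mul_pow, pow_succ r⁻¹ k, inv_pow, inv_pow]
    field_simp
  rw [key]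
  have hrk : 0 ≤ r ^ k := by positivity
  calc r ^ k * (Real.exp (-(10 * K')) * (2 * r)⁻¹ ^ (k + 1))
      = 4 / 3 * (r ^ k * (3 / 4 * (Real.exp (-(10 * K')) * (2 * r)⁻¹ ^ (k + 1)))) := by ring
    _ ≤ 4 / 3 * (r ^ k * (r⁻¹ ^ k * (Module.finrank ℚ K * N))) :=
        mul_le_mul_of_nonneg_left (mul_le_mul_of_nonneg_left hkey hrk) (by norm_num)
    _ = 4 / 3 * Module.finrank ℚ K * N := by
        rw [← mul_assoc (r ^ k), ← mul_pow, mul_inv_cancel₀ hr.ne', one_pow, one_mul]; ring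

/-- **Bombieri's Lemme B for `ζ₁_K`, degree `n_K ≤ 3`, away from the pole** (uniformly in the field):
there are absolute `A₀, r₀ > 0` such that for `ℒ'_v ≤ L'`, `0 < r ≤ r₀`, `rL' ≥ 1`, `4e^{10} r ≤ |v|`,
a zero `ρ₀` of `ζ_K` with `|ρ₀ − (1 + iv)| ≤ r`, `0 < x`, `log x ≥ A₀ L'` and `z ≤ x^{a₀/2}`,
`e^{−10}/16 · x^{−r/10}/r³ ≤ ∫_{⌊x^{a₀}⌋}^{x} ‖Σ_{⌊x^{a₀}⌋ < n ≤ t, n = p^m, p > z} b_n‖² dt/t`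
(slack `η = (4/3) n_K ≤ 4` in `lemmeB_core_abstract`, and `η² ≤ 16`).
[cite: Bombieri1987GrandCrible, §6 Lemme B] -/
theorem lemmeB_dedekindZeta₁_of_finrank_le_three :
    ∃ A₀ r₀ : ℝ, 0 < A₀ ∧ 0 < r₀ ∧
      ∀ (K : Type*) [Field K] [NumberField K], Module.finrank ℚ K ≤ 3 →
      ∀ (v r L' x : ℝ) (z : ℕ), lemmaAHeight K v ≤ L' → 0 < r → r ≤ r₀ → 1 ≤ r * L' →
        4 * Real.exp 10 * r ≤ |v| →
        (∃ ρ₀ : ℂ, dedekindZeta₁ K ρ₀ = 0 ∧ ‖ρ₀ - (1 + (v : ℂ) * I)‖ ≤ r) →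
        0 < x → A₀ * L' ≤ Real.log x → (z : ℝ) ≤ x ^ (expoB / 2) →
          Real.exp (-10) / 16 * x ^ (-(r / 10)) / r ^ 3 ≤
            ∫ t in Set.Ioc (⌊x ^ expoB⌋₊ : ℝ) x, ‖summatory (coefSiftedB (coefB K 1 v) x z) t‖ ^ 2 / t := by
  obtain ⟨c₄, hc₄, hA⟩ := exists_norm_tsum_gTermB_ge_dedekindZeta₁_sharp
  set θ : ℝ := Real.exp 14 with hθ
  have hθ1 : 1 ≤ θ := Real.one_le_exp (by norm_num)
  refine ⟨240 * (c₄ + 8 * θ + 8), 1 / (112 * θ), by positivity, by positivity,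
    fun K _ _ hnK v r L' x z hL hr hr0 hu hv hzero hx hlogx hz => ?_⟩
  have hL'1 : 1 ≤ L' := (one_le_lemmaAHeight v).trans hL
  set u : ℝ := r * L' with hudef
  have hr1 : r ≤ 1 := by
    have : 1 / (112 * θ) ≤ 1 := by rw [div_le_one (by positivity)]; nlinarith
    linarith
  have hr8 : 512 * r ≤ 1 / 8 := by
    have h := hr0
    rw [le_div_iff₀ (by positivity)] at h
    have h14 : (4096 : ℝ) ≤ θ := by
      have := pow_le_exp_mul (c := 4096) (m := 14) (by norm_num) (by norm_num) 1
      simpa [hθ] using this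
    nlinarith
  set Lx : ℝ := Real.log x with hLx
  have hA₀pos : 0 < 240 * (c₄ + 8 * θ + 8) := by positivity
  have hLxpos : 0 < Lx := lt_of_lt_of_le (by positivity) hlogx
  have hrLx : 240 * (c₄ + 8 * θ + 8) * u ≤ r * Lx := by
    rw [hudef]
    have := mul_le_mul_of_nonneg_left hlogx hr.le
    linarith
  set K' : ℕ := ⌊r * Lx / 240⌋₊ with hKdef
  have hK1 : (K' : ℝ) ≤ r * Lx / 240 := Nat.floor_le (by positivity)
  have hKlow : (c₄ + 8 * θ + 8) * u - 1 ≤ K' := by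
    have hK2 : r * Lx / 240 < K' + 1 := Nat.lt_floor_add_one _
    have : (c₄ + 8 * θ + 8) * u ≤ r * Lx / 240 := by
      rw [le_div_iff₀ (by norm_num)]; linarith
    linarith
  have hu1 : (1 : ℝ) ≤ u := hu
  have hprod1 : 0 ≤ (8 * θ + 8) * (u - 1) := mul_nonneg (by positivity) (by linarith only [hu1])
  have hprod2 : 0 ≤ c₄ * u := mul_nonneg hc₄.le (by linarith only [hu1])
  have hKc : c₄ * (r * L') + 2 ≤ K' := by
    rw [← hudef]
    nlinarith only [hKlow, hprod1, hθ1, hu1]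
  have hK8r : (8 : ℝ) ≤ K' := by
    nlinarith only [hKlow, hprod1, hprod2, hθ1, hu1]
  have hK8 : 8 ≤ K' := by exact_mod_cast hK8r
  have hKθ : 8 * θ * u ≤ K' := by
    nlinarith only [hKlow, hprod2, hu1]
  obtain ⟨k, hk, hmain⟩ := hA K v r L' hL hr hr8 hu hv hzero K' hKc
  have hnK1 : (1 : ℝ) ≤ Module.finrank ℚ K := by exact_mod_cast Module.finrank_pos (R := ℚ) (M := K)
  have hnK3 : (Module.finrank ℚ K : ℝ) ≤ 3 := by exact_mod_cast hnK
  have hη1 : (1 : ℝ) ≤ 4 / 3 * (Module.finrank ℚ K : ℝ) := by linarith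
  have hη4 : 4 / 3 * (Module.finrank ℚ K : ℝ) ≤ 4 := by linarith
  have hcore := lemmeB_core_abstract (norm_coefB_le 1 v) (fun n hn ↦ coefB_eq_zero_of_not_isPrimePow 1 v hn)
    hr hr0 hu hx hη1 hη4 hK8 hKθ hk (summable_gTermB_coefB 1 v hr k) hmain hz
  refine le_trans ?_ hcore
  -- `e^{-10}/16 ≤ e^{-10}/((4/3) n_K)²`
  have hsq : (4 / 3 * (Module.finrank ℚ K : ℝ)) ^ 2 ≤ 16 := by nlinarith only [hnK1, hnK3]
  have hsqpos : 0 < (4 / 3 * (Module.finrank ℚ K : ℝ)) ^ 2 := by positivity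
  have hxr : 0 ≤ x ^ (-(r / 10)) / r ^ 3 := by positivity
  have h1 : Real.exp (-10) / 16 ≤ Real.exp (-10) / (4 / 3 * (Module.finrank ℚ K : ℝ)) ^ 2 :=
    div_le_div_of_nonneg_left (Real.exp_pos _).le hsqpos hsq
  calc Real.exp (-10) / 16 * x ^ (-(r / 10)) / r ^ 3 = Real.exp (-10) / 16 * (x ^ (-(r / 10)) / r ^ 3) := by ring
    _ ≤ Real.exp (-10) / (4 / 3 * (Module.finrank ℚ K : ℝ)) ^ 2 * (x ^ (-(r / 10)) / r ^ 3) :=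
        mul_le_mul_of_nonneg_right h1 hxr
    _ = _ := by ring

end Literature.NumberTheory.LFunctions.NumberField

end
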